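import Literature.MathematicalPhysics.QuantumFieldTheory.Balaban1983to89.B6Eq295

/-!
# `Balaban1983to89.B6Eq2102Gaussian` — T. Bałaban, *Propagators and renormalization transformations for lattice
# gauge theories. II*, Commun. Math. Phys. **96** (1984) 223–250 [Balaban1984PropagatorsII], Sect. C (2.102) p. 241:
# the Gaussian integral `Z′_j⁻¹∫dλ′δ(Q′_jλ′ − μ)e^{−½‖Δλ′‖²}` *"connected with"* `H′_j` *"in the same way as the operator
# H_k was connected with the integral (1.47)"* — PROVED: over the fibre `{Q′_jλ′ = μ} = H′_jμ + N(Q′_j)` the integral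
# equals `e^{−½‖ΔH′_jμ‖²} = e^{−½⟨μ,Δ′_jμ⟩}` times a `μ`-independent constant, and `H′_jμ` is its mean

statement-level skeleton of published theorems with citation tags; proofs where landed; nothing here is a claim about the Yang–Mills mass gap

PDF held: `paper:balaban1984-cmp96-propagators-rt-ii` (journal page = PDF page + 222); p. 241 read AS IMAGE on the ×2
render `run/shared/lean/pub/pub-balaban/b2b-balaban-ref1/pages/1984-cmp96-propagators-rt-II/…-p019-x2.png` (2026-08-21).

CITATION HEADER (lean-in-tree rule).  WHAT IS REPRODUCED: lit-balaban SKELETON row **B6.Eq2.102** ((2.102) p. 241; cell: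
*"variational characterisation of H′_j PROVED; the Gaussian-integral phrasing of (2.102) located"*) — the located
Gaussian phrasing.  PHASE-2 proof seat p22 (gen 6), unit `lit-balaban-p22-g6`; owner r03, referee ref-4; HOME
`run/shared/lean/pub/lit-balaban/`.  Theorems only, in the letters of r03's `…B6Eq295` §3 (`H′_j` =
`…B6SectA.hOp (Δ⁻¹∘Δ⁻¹) Q′_j* E`, the orthogonality `…B6Eq295.norm_lap_sq_eq_add`, the variational half
`…B6Eq295.hPrime_minimises`, (2.107) `…B6Eq295.inner_deltaPrimeJ_eq_norm_sq` — consumed by name, nothing restated).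

PRINT (p. 241 [PDF 19], verbatim).  *"λ = Δ⁻²Q′_j*(Q′_jΔ⁻²Q′_j*)⁻¹μ, μ = Q′_jλ. (2.101) … Let us consider this formula
more closely. It is easy to see that it defines an operator which is connected with the integral
  Z′_j⁻¹ ∫dλ′ δ(Q′_jλ′ − μ) e^{−½‖Δλ′‖²}   (2.102)
in the same way as the operator H_k was connected with the integral (1.47). It gives a solution of the variational
problem inf_{λ′:Q′_jλ′=μ} ½‖Δλ′‖². Let us denote the operator in (2.101) by H′_j, so λ = H′_jμ."*  The connection of
`H_k` with (1.47) of [4] (= B5) is (1.64) there: the translation `A = A′ + H_kB` evaluates the constrained Gaussian as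
`Z_k exp(−½⟨∂H_kB, ∂H_kB⟩)`; p. 242 uses the same translation here: *"the second equality was obtained by the
translation λ′ → λ′ + H′_jω … and the operator Δ′_j was defined by the second equality, Δ′_j = H′_j*Δ²H′_j. (2.107)"*.

HOW IT IS TYPED (as in `…B6Eq295` §4).  `∫dλ′ δ(Q′_jλ′ − μ) F(λ′)` is the integral of `F` over the fibre
`{Q′_jλ′ = μ} = H′_jμ + N(Q′_j)` (`Q′_jH′_jμ = μ`, `…B6Eq295.comp_hPrime_eq_id`), parametrised as `H′_jμ + ι n` with
`ι : N →ₗ B` into `N(Q′_j)` (`Q′_j(ι n) = 0`) and ANY measure `ν` on the parameter space (Lebesgue measure on `N(Q′_j)`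
is one); no integrability hypothesis is needed (both sides vanish alike otherwise).

CONTENTS.  `norm_sq_fibre` (on the fibre, `‖Δ(H′_jμ + λ″)‖² = ‖ΔH′_jμ‖² + ‖Δλ″‖²` — the translation, no cross term),
**`eq2102`** (`∫dλ′δ(Q′_jλ′−μ)e^{−½‖Δλ′‖²} = e^{−½‖ΔH′_jμ‖²}·∫dλ′δ(Q′_jλ′)e^{−½‖Δλ′‖²}` — the (1.64)-type
evaluation), `eq2102_deltaPrimeJ` (the same with `‖ΔH′_jμ‖² = ⟨μ,Δ′_jμ⟩`, `Δ′_j = H′_j*Δ²H′_j` (2.107): the integral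
(2.102) is the Gaussian `e^{−½⟨μ,Δ′_jμ⟩}` in `μ` up to a constant), `eq2102_normalised` (with the printed prefactor
`Z′_j⁻¹`), `mean_2102` (`H′_jμ` is the mean of the fibre Gaussian: `∫dλ′δ(Q′_jλ′−μ)e^{−½‖Δλ′‖²}⟨λ′ − H′_jμ, g⟩ = 0`
for a reflection-invariant `ν`).
Unit `lit-balaban-p22` (PHASE-2 proof seat, gen 6), HOME `run/shared/lean/pub/lit-balaban/`, 2026-08-21.
-/

noncomputable section

open MeasureTheory
open scoped InnerProductSpace

namespace Literature.MathematicalPhysics.QuantumFieldTheory.Balaban1983to89.B6Eq2102Gaussian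

variable {B W N : Type*} [NormedAddCommGroup B] [InnerProductSpace ℝ B] [NormedAddCommGroup W]
  [InnerProductSpace ℝ W] [AddCommGroup N] [Module ℝ N] [MeasurableSpace N]

/-- **The translation `λ′ → λ′ + H′_jμ`, pointwise:** on the fibre `{Q′_jλ′ = μ}`, written `λ′ = H′_jμ + λ″` with
`Q′_jλ″ = 0`, `‖Δλ′‖² = ‖ΔH′_jμ‖² + ‖Δλ″‖²` (no cross term: `Δ²H′_jμ = Q′_j*Eμ ⊥ N(Q′_j)`; `…B6Eq295.norm_lap_sq_eq_add`).
Letters: `Δ` symmetric with `ΔΔ⁻¹ = I`, `Q′_j*` the adjoint of `Q′_j`, `H′_j = Δ⁻²Q′_j*E`.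
[cite: Balaban1984PropagatorsII, (2.102) p.241] -/
theorem norm_sq_fibre (lap Dinv : B →ₗ[ℝ] B) (Qp : B →ₗ[ℝ] W) (Qps : W →ₗ[ℝ] B) (E : W →ₗ[ℝ] W)
    (hlap : ∀ x y : B, ⟪lap x, y⟫_ℝ = ⟪x, lap y⟫_ℝ) (hadj : ∀ (w : W) (v : B), ⟪Qps w, v⟫_ℝ = ⟪w, Qp v⟫_ℝ)
    (hinv : lap ∘ₗ Dinv = LinearMap.id) (m : W) (l'' : B) (hl'' : Qp l'' = 0) :
    ‖lap (B6SectA.hOp (Dinv ∘ₗ Dinv) Qps E m + l'')‖ ^ 2 =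
      ‖lap (B6SectA.hOp (Dinv ∘ₗ Dinv) Qps E m)‖ ^ 2 + ‖lap l''‖ ^ 2 := by
  set h := B6SectA.hOp (Dinv ∘ₗ Dinv) Qps E m with hh
  have hQ : Qp (h + l'') = Qp h := by rw [map_add, hl'', add_zero]
  have hsplit := B6Eq295.norm_lap_sq_eq_add lap Dinv Qp Qps E hlap hadj hinv m (h + l'') hQ
  rwa [add_sub_cancel_left] at hsplit

/-- **(2.102) evaluated by the translation `λ′ → λ′ + H′_jμ` (the way `H_k` is *"connected with the integral (1.47)"*,
i.e. (1.64) of [4]):** `∫dλ′ δ(Q′_jλ′ − μ) e^{−½‖Δλ′‖²} = e^{−½‖ΔH′_jμ‖²} · ∫dλ′ δ(Q′_jλ′) e^{−½‖Δλ′‖²}`, for ANY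
measure `ν` on any linear parametrisation `ι` of `N(Q′_j)` (the fibre being `H′_jμ + N(Q′_j)`).
[cite: Balaban1984PropagatorsII, (2.102) p.241] -/
theorem eq2102 (ν : Measure N) (ι : N →ₗ[ℝ] B) (lap Dinv : B →ₗ[ℝ] B) (Qp : B →ₗ[ℝ] W) (Qps : W →ₗ[ℝ] B)
    (E : W →ₗ[ℝ] W) (hlap : ∀ x y : B, ⟪lap x, y⟫_ℝ = ⟪x, lap y⟫_ℝ)
    (hadj : ∀ (w : W) (v : B), ⟪Qps w, v⟫_ℝ = ⟪w, Qp v⟫_ℝ) (hinv : lap ∘ₗ Dinv = LinearMap.id)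
    (hι : ∀ n, Qp (ι n) = 0) (m : W) :
    ∫ n, Real.exp (-(1 / 2) * ‖lap (B6SectA.hOp (Dinv ∘ₗ Dinv) Qps E m + ι n)‖ ^ 2) ∂ν =
      Real.exp (-(1 / 2) * ‖lap (B6SectA.hOp (Dinv ∘ₗ Dinv) Qps E m)‖ ^ 2) *
        ∫ n, Real.exp (-(1 / 2) * ‖lap (ι n)‖ ^ 2) ∂ν := by
  have hfun : (fun n => Real.exp (-(1 / 2) * ‖lap (B6SectA.hOp (Dinv ∘ₗ Dinv) Qps E m + ι n)‖ ^ 2)) =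
      fun n => Real.exp (-(1 / 2) * ‖lap (B6SectA.hOp (Dinv ∘ₗ Dinv) Qps E m)‖ ^ 2) *
        Real.exp (-(1 / 2) * ‖lap (ι n)‖ ^ 2) := by
    funext n
    rw [norm_sq_fibre lap Dinv Qp Qps E hlap hadj hinv m (ι n) (hι n), mul_add, Real.exp_add]
  rw [hfun, integral_const_mul]

/-- **(2.102) is the Gaussian `e^{−½⟨μ,Δ′_jμ⟩}` in `μ`, `Δ′_j = H′_j*Δ²H′_j` ((2.107)):**
`∫dλ′ δ(Q′_jλ′ − μ) e^{−½‖Δλ′‖²} = e^{−½⟨μ,Δ′_jμ⟩} · ∫dλ′ δ(Q′_jλ′) e^{−½‖Δλ′‖²}` (`H′_j*` = `hPs` the adjoint of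
`H′_j`; `‖ΔH′_jμ‖² = ⟨μ,Δ′_jμ⟩` is `…B6Eq295.inner_deltaPrimeJ_eq_norm_sq`). [cite: Balaban1984PropagatorsII, (2.102) p.241 + (2.107) p.242] -/
theorem eq2102_deltaPrimeJ (ν : Measure N) (ι : N →ₗ[ℝ] B) (lap Dinv : B →ₗ[ℝ] B) (Qp : B →ₗ[ℝ] W)
    (Qps : W →ₗ[ℝ] B) (E : W →ₗ[ℝ] W) (hPs : B →ₗ[ℝ] W) (hlap : ∀ x y : B, ⟪lap x, y⟫_ℝ = ⟪x, lap y⟫_ℝ)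
    (hadj : ∀ (w : W) (v : B), ⟪Qps w, v⟫_ℝ = ⟪w, Qp v⟫_ℝ) (hinv : lap ∘ₗ Dinv = LinearMap.id)
    (hH : ∀ (w : W) (b : B), ⟪B6SectA.hOp (Dinv ∘ₗ Dinv) Qps E w, b⟫_ℝ = ⟪w, hPs b⟫_ℝ)
    (hι : ∀ n, Qp (ι n) = 0) (m : W) :
    ∫ n, Real.exp (-(1 / 2) * ‖lap (B6SectA.hOp (Dinv ∘ₗ Dinv) Qps E m + ι n)‖ ^ 2) ∂ν =
      Real.exp (-(1 / 2) * ⟪m, (hPs ∘ₗ lap ∘ₗ lap ∘ₗ B6SectA.hOp (Dinv ∘ₗ Dinv) Qps E) m⟫_ℝ) *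
        ∫ n, Real.exp (-(1 / 2) * ‖lap (ι n)‖ ^ 2) ∂ν := by
  rw [eq2102 ν ι lap Dinv Qp Qps E hlap hadj hinv hι m,
    (B6Eq295.inner_deltaPrimeJ_eq_norm_sq lap (B6SectA.hOp (Dinv ∘ₗ Dinv) Qps E) hPs hlap hH m).1]

/-- **(2.102) with the printed prefactor:** `Z′_j⁻¹∫dλ′δ(Q′_jλ′ − μ)e^{−½‖Δλ′‖²} = e^{−½‖ΔH′_jμ‖²} · Z′_j⁻¹∫dλ′δ(Q′_jλ′)e^{−½‖Δλ′‖²}`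
(`Z′_j` any constant). [cite: Balaban1984PropagatorsII, (2.102) p.241] -/
theorem eq2102_normalised (ν : Measure N) (ι : N →ₗ[ℝ] B) (lap Dinv : B →ₗ[ℝ] B) (Qp : B →ₗ[ℝ] W)
    (Qps : W →ₗ[ℝ] B) (E : W →ₗ[ℝ] W) (hlap : ∀ x y : B, ⟪lap x, y⟫_ℝ = ⟪x, lap y⟫_ℝ)
    (hadj : ∀ (w : W) (v : B), ⟪Qps w, v⟫_ℝ = ⟪w, Qp v⟫_ℝ) (hinv : lap ∘ₗ Dinv = LinearMap.id)
    (hι : ∀ n, Qp (ι n) = 0) (Zj : ℝ) (m : W) :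
    Zj⁻¹ * ∫ n, Real.exp (-(1 / 2) * ‖lap (B6SectA.hOp (Dinv ∘ₗ Dinv) Qps E m + ι n)‖ ^ 2) ∂ν =
      Real.exp (-(1 / 2) * ‖lap (B6SectA.hOp (Dinv ∘ₗ Dinv) Qps E m)‖ ^ 2) *
        (Zj⁻¹ * ∫ n, Real.exp (-(1 / 2) * ‖lap (ι n)‖ ^ 2) ∂ν) := by
  rw [eq2102 ν ι lap Dinv Qp Qps E hlap hadj hinv hι m]
  ring

/-- **`H′_jμ` is the mean of the fibre Gaussian (2.102)** (the translated integrand is even in `λ″`, the odd moment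
vanishes for a reflection-invariant `ν`): `∫dλ′ δ(Q′_jλ′ − μ) e^{−½‖Δλ′‖²} ⟨λ′ − H′_jμ, g⟩ = 0` — the configuration
about which the Gaussian of (2.102) is centred is `λ = H′_jμ` ((2.101)), as `H_kB` for (1.47).
[cite: Balaban1984PropagatorsII, (2.101)–(2.102) p.241] -/
theorem mean_2102 [MeasurableNeg N] (ν : Measure N) [ν.IsNegInvariant] (ι : N →ₗ[ℝ] B) (lap Dinv : B →ₗ[ℝ] B)
    (Qp : B →ₗ[ℝ] W) (Qps : W →ₗ[ℝ] B) (E : W →ₗ[ℝ] W) (hlap : ∀ x y : B, ⟪lap x, y⟫_ℝ = ⟪x, lap y⟫_ℝ)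
    (hadj : ∀ (w : W) (v : B), ⟪Qps w, v⟫_ℝ = ⟪w, Qp v⟫_ℝ) (hinv : lap ∘ₗ Dinv = LinearMap.id)
    (hι : ∀ n, Qp (ι n) = 0) (m : W) (g : B) :
    ∫ n, Real.exp (-(1 / 2) * ‖lap (B6SectA.hOp (Dinv ∘ₗ Dinv) Qps E m + ι n)‖ ^ 2) *
      ⟪(B6SectA.hOp (Dinv ∘ₗ Dinv) Qps E m + ι n) - B6SectA.hOp (Dinv ∘ₗ Dinv) Qps E m, g⟫_ℝ ∂ν = 0 := by
  have hpt : ∀ n, Real.exp (-(1 / 2) * ‖lap (B6SectA.hOp (Dinv ∘ₗ Dinv) Qps E m + ι n)‖ ^ 2) *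
      ⟪(B6SectA.hOp (Dinv ∘ₗ Dinv) Qps E m + ι n) - B6SectA.hOp (Dinv ∘ₗ Dinv) Qps E m, g⟫_ℝ =
      Real.exp (-(1 / 2) * ‖lap (B6SectA.hOp (Dinv ∘ₗ Dinv) Qps E m)‖ ^ 2) *
        (Real.exp (-(1 / 2) * ‖lap (ι n)‖ ^ 2) * ⟪ι n, g⟫_ℝ) := by
    intro n
    rw [norm_sq_fibre lap Dinv Qp Qps E hlap hadj hinv m (ι n) (hι n), mul_add, Real.exp_add,
      add_sub_cancel_left, mul_assoc]
  simp_rw [hpt]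
  rw [integral_const_mul]
  have hodd : ∫ n, Real.exp (-(1 / 2) * ‖lap (ι n)‖ ^ 2) * ⟪ι n, g⟫_ℝ ∂ν = 0 := by
    have h := integral_neg_eq_self (fun n => Real.exp (-(1 / 2) * ‖lap (ι n)‖ ^ 2) * ⟪ι n, g⟫_ℝ) ν
    simp only [map_neg, norm_neg, inner_neg_left, mul_neg] at h
    rw [integral_neg] at h
    linarith
  rw [hodd, mul_zero]

end Literature.MathematicalPhysics.QuantumFieldTheory.Balaban1983to89.B6Eq2102Gaussian

end
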